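import Literature.AlgebraicGeometry.Motives.HodgeStructureLefschetzGroupCentralFieldSplitting
import Literature.AlgebraicGeometry.Motives.HodgeStructureEndAlgCentralizerInvolutionBlocks
import HarnessLib

/-!
# Milne 1999 §2, type IV on points: the representation of `S_σ ≅ GL(e V_{K,τₛ})` on the pair of blocks
# `V_σ = V_{K,τₛ} ⊕ V_{K,τₛ∘σ}` is `d` copies of the STANDARD representation and `d` copies of its CONTRAGREDIENT
# ("The representation of `S_σ` on `V_σ` is isomorphic to the direct sum of `d` copies of the standard representation of
# `GL_{g/fd}(k^al)` and `d` copies of its contragredient")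

[topic AlgebraicGeometry/Motives]

Layer `Literature/AlgebraicGeometry/Motives`, lane `lit-hodgefound` (Track 2 foundations library; seat `lit-hodgefound-p34`,
generation 23, self-proposed row g23-#1 — free pointer (m) of the seat sheet, the LAST printed sentence of Milne's type IV
paragraph, which the seat's `Motives/HodgeStructureLefschetzGroupCentralFieldSplitting` lists under "NOT here": "the
representation-theoretic sentence … beyond `MatrixAlgAction.cornerDecomposition` BY NAME and the contragredient partner blocks").
Milne computes, for a simple abelian variety of type IV over `k^al`, `S(A)_{/k^al} = ∏_σ S_σ` with
`S_σ ≈ Aut_{M_d(k^al)}(V₁) ≈ GL_{g/df}(k^al)` acting on `V_σ = V₁ ⊕ V₂`, `V₂ = V₁^∨`, and closes: "The representation of `S_σ`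
on `V_σ` is isomorphic to the direct sum of `d` copies of the standard representation of `GL_{g/fd}(k^al)` and `d` copies of
its contragredient." This file is that sentence on `K`-points of the abstract polarized `ℚ`-Hodge structure with a number field
`F` acting centrally, on top of the seat's `Motives/HodgeStructureLefschetzGroupCentralFieldSplitting`
(`Polarization.lefschetzGroupBaseChangeEquivCornerBlocks : S(H)(K) ≃* ∏_{s ∈ Φ} GL(e V_{K,τₛ})`, the `GL_{g/df}` of each pair),
`LinearAlgebra/Matrix/MatrixAlgebraModuleCorner` (`MatrixAlgAction.cornerDecomposition : V ≅ (eV)^ι`) and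
`Motives/HodgeStructureEndAlgCentralizerInvolutionBlocks` (`Polarization.blockPairing`, the perfect pairing
`Q_K : V_{K,τₛ} × V_{K,τₛ∘σ} → K` of Remark 2.2): definitions WITH BODIES (`Polarization.restrictBlockEquiv`,
`Polarization.blockDuality`, `Polarization.partnerDualDecomposition`, `Polarization.pairDecomposition`) and theorems;
no named fact (net debt `0`).

## The source, verbatim

J. S. Milne, *Lefschetz classes on abelian varieties*, Duke Math. J. **96** (1999) 639–675 [Milne1999LefschetzClasses]
(held `paper:doi-10-1215-s0012-7094-99-09620-5`; Duke page = folio + 638), §2: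
* (Remark 2.2, p. 647 L66 – p. 648 L7) "there is a nondegenerate `Ω`-bilinear form `φ₁ : V₁ × V₂ → Ω` […] the map `α ↦ α|V₁ :
  U(φ)_Ω → GL(V₁)` is an isomorphism, and the representation of `U(φ)_Ω` on `V ⊗_k Ω` becomes the direct sum of the representation
  of `GL(V₁)` on `V₁` (standard representation) and the representation of `GL(V₁)` on `V₂` (contragredient of the standard
  representation)."
* (Remark 2.3, p. 648 L13–L17) "the choice of an `E`-linear isomorphism `V → S^t` determines an isomorphism
  `C(E) = End_E(V) → M_t(Δ)`."
* (type IV, p. 650 L66 – p. 651 L2) "Let `S` be a simple `M_d(k^al)`-module, and let `V₁ = S ⊕ ⋯ ⊕ S` (`g/df` copies). Then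
  `V₁` is a `k^al`-vector space of dimension `g/f`. Let `V₂ = V₁^∨`. It has a natural structure of a right `M_d(k^al)`-module,
  which we turn into a left module structure by using the involution `α ↦ αᵗʳ`. The bilinear form
  `(x₁, x₂) ↦ φ₀(x₁, x₂) = x₂(x₁) : V₁ × V₂ → k`".
* (p. 651 L72–L81) "`S(A)_{/k^al} = ∏ S_σ` where `S_σ ≈ Aut_{M_d(k^al)}(V₁) ≈ GL_{g/fd}(k^al)`. The representation of `S_σ`
  on `V_σ` is isomorphic to the direct sum of `d` copies of the standard representation of `GL_{g/fd}(k^al)` and `d` copies of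
  its contragredient."

DICTIONARY. `V_σ = V₁ ⊕ V₂` is the pair of blocks `V_{K,τₛ} ⊕ V_{K,τₛ∘σ}` of `K ⊗ V` (a representative `s ∈ Φ` and its
partner), `S_σ` is the factor `GL(e V_{K,τₛ})` of `S(H)(K) ≃* ∏_{s ∈ Φ} GL(e V_{K,τₛ})` (the corner `e V_{K,τₛ}`, `e = ρₛ(E_{i₀i₀})`,
of a splitting `ρₛ : M_ι(K) → End_K(V_{K,τₛ})` of `E_φ ⊗ K` on the block — Milne's simple `M_d(k^al)`-module `S`, `d = card ι`);
"`d` copies of the standard representation" is `V_{K,τₛ} ≅ (e V_{K,τₛ})^ι` (`MatrixAlgAction.cornerDecomposition`,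
`v ↦ (u_{i₀ j} v)_j`) on which `γ ∈ S(H)(K)` acts diagonally through `γ|eV_{K,τₛ}`; "`d` copies of its contragredient" is
`V_{K,τₛ∘σ} ≅ V_{K,τₛ}^∨ ≅ ((e V_{K,τₛ})^∨)^ι` (`y ↦ (x ↦ Q_K(u_{j i₀} x, y))_j`) on which `γ` acts diagonally through
`φ ↦ φ ∘ (γ|eV_{K,τₛ})⁻¹`, because `γ` preserves `Q_K` and commutes with the matrix units `u_{kl} ∈ K·(E_φ|V_{K,τₛ})`.

## What is PROVED

* §1 (block level, every `χ`) `EndAction.apply_mem_eigenspaceBaseChange_of_mem_lefschetzGroupBaseChange` (`γ ∈ S(H)(K)`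
  preserves every block), DEF **`Polarization.restrictBlockEquiv … hγ χ : V_{K,χ} ≃ₗ[K] V_{K,χ}`** (`γ|V_{K,χ}`, inverse
  `γ⁻¹|V_{K,χ}`; `coe_restrictBlockEquiv_apply`, `restrictBlockEquiv_symm_apply_coe`), DEF **`Polarization.blockDuality … s :
  V_{K,τₛ∘σ} ≃ₗ[K] Dual_K V_{K,τₛ}`** (`y ↦ Q_K(·, y)`, Milne's "`V₂ = V₁^∨`", from the perfect pairing of Remark 2.2;
  `blockDuality_apply`) and **`Polarization.blockDuality_restrictBlockEquiv`**: `γ|V_{K,τₛ∘σ} = ᵗ(γ|V_{K,τₛ})⁻¹` under the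
  duality ("the representation … on `V₂` (contragredient of the standard representation)").
* §2 (corner level, splittings `ρₛ` of the representative blocks `s ∈ Φ`, as in the seat's type IV file)
  `Polarization.restrictBlockEquiv_eq_coe_lefschetzGroupBaseChangeEquivBlockCentralizers` (dictionary with the seat's block
  isomorphism), `Polarization.restrictBlockEquiv_comp_unit` (`γ|V_{K,τₛ}` commutes with the matrix units `u_{kl}`),
  **`Polarization.cornerDecomposition_restrictBlockEquiv_apply`** ("`d` copies of the standard representation":
  `(γ v)_j = γ|eV · v_j` in `V_{K,τₛ} ≅ (e V_{K,τₛ})^ι`), DEF **`Polarization.partnerDualDecomposition … s :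
  V_{K,τₛ∘σ} ≃ₗ[K] (ι → Dual_K (e V_{K,τₛ}))`** (`blockDuality`, then the transpose of `cornerDecomposition`, then
  `LinearMap.lsum`; `partnerDualDecomposition_apply : (… y) j x = Q_K(u_{j i₀} x, y)`), and
  **`Polarization.partnerDualDecomposition_restrictBlockEquiv_apply`** ("`d` copies of its contragredient":
  `(γ y)_j = y_j ∘ (γ|eV)⁻¹`).
* §3 DEF **`Polarization.pairDecomposition … s : V_{K,τₛ} × V_{K,τₛ∘σ} ≃ₗ[K] (ι → e V_{K,τₛ}) × (ι → Dual_K (e V_{K,τₛ}))`**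
  (Milne's `V_σ = V₁ ⊕ V₂ ≅ S^{g/df} ⊕ (S^{g/df})^∨` read through the Morita equivalence) and
  **`Polarization.pairDecomposition_restrictBlockEquiv`**: `γ ∈ S(H)(K)` acts on the pair as
  `(std(γ|eV))^ι ⊕ (contragredient(γ|eV))^ι`, where `γ ↦ γ|eV_{K,τₛ}` IS the `s`-component of the seat's
  `S(H)(K) ≃* ∏_{s ∈ Φ} GL(e V_{K,τₛ})` — the printed sentence.

NOT here (honest): the statement for the algebraic group `S_σ` (only its `K`-points `S(H)(K)` and their images `γ|eV_{K,τₛ}`,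
which EXHAUST `GL(e V_{K,τₛ})` by the seat's `lefschetzGroupBaseChangeEquivCornerBlocks`); the analogous closing sentences for
types II/III ("its representation on `V_{σ₂}` is the contragredient of the standard representation (which is isomorphic to the
standard representation)" — the self-duality of `Sp`/`O` is not treated); existence of the splittings `ρₛ` is the seat's
`EndAction.exists_matrixAlgHom_span_blockOp_eq_range` (algebraically closed `K`) and is taken as data here. HC is NOT proved;
nothing here claims a case of the Hodge conjecture.

## References

* [Milne1999LefschetzClasses] J. S. Milne, *Lefschetz classes on abelian varieties*, Duke Math. J. 96 (1999) 639–675 — §2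
  Remark 2.2 (pp. 647–648), Remark 2.3 (p. 648), pp. 650–651 (type IV, `V₂ = V₁^∨`, "`d` copies of the standard representation
  … and `d` copies of its contragredient").
* [Deligne1982HodgeCycles] P. Deligne, *Hodge cycles on abelian varieties*, LNM 900 (1982) — §4 (the decomposition
  `H¹ ⊗ K = ⊕_σ H¹_σ` along the action of a field and its pairing under a polarization).
* [KnusEtAl1998] M.-A. Knus, A. Merkurjev, M. Rost, J.-P. Tignol, *The Book of Involutions*, AMS Colloquium Publications 44
  (1998), Ch. I §4.A (Morita theory for modules over `M_m(R)`; Milne's "Knus 1991, I.9.5").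
-/

noncomputable section

open scoped TensorProduct
open Function Module

namespace Literature.AlgebraicGeometry.Motives

open Literature.LinearAlgebra.Matrix (MatrixAlgAction.unit MatrixAlgAction.corner MatrixAlgAction.toCorner
  MatrixAlgAction.coe_toCorner_apply MatrixAlgAction.fromCorner MatrixAlgAction.fromCorner_apply MatrixAlgAction.cornerDecomposition
  MatrixAlgAction.cornerDecomposition_apply MatrixAlgAction.cornerDecomposition_symm_apply MatrixAlgAction.toCorner_fromCorner_same
  MatrixAlgAction.toCorner_fromCorner_of_ne MatrixAlgAction.isometryCentralizer MatrixAlgAction.mem_isometryCentralizer_range_iff)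

namespace HodgeStructure

universe u uK

variable {V : Type u} [AddCommGroup V] [Module ℚ V] {n : ℤ} {H : HodgeStructure V n}
variable {F : Type*} [Field F] [NumberField F]
variable (K : Type uK) [Field K] [Algebra ℚ K] (A : EndAction H F) {S : Type*} (τ : S → (F →ₐ[ℚ] K))
variable (Q : Polarization H) (σ : F ≃ₐ[ℚ] F)

/-! ## §1 Block level: `γ|V_{K,χ}` for `γ ∈ S(H)(K)`, the duality `V_{K,τₛ∘σ} ≅ V_{K,τₛ}^∨` and `γ|V₂ = ᵗ(γ|V₁)⁻¹` -/

/-- **`γ ∈ S(H)(K)` preserves every block `V_{K,χ}`** (it commutes with `ι(F)_K ⊆ E_φ ⊗ K`): "any `k`-linear map `α` commuting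
with the action of `F` decomposes into `α = α₁ ⊕ ⋯ ⊕ α_t`". [cite: Milne1999LefschetzClasses, §2 p. 646 L50–L52] -/
theorem EndAction.apply_mem_eigenspaceBaseChange_of_mem_lefschetzGroupBaseChange {γ : (K ⊗[ℚ] V) ≃ₗ[K] (K ⊗[ℚ] V)}
    (hγ : γ ∈ Q.lefschetzGroupBaseChange K) (χ : F →ₐ[ℚ] K) {x : K ⊗[ℚ] V} (hx : x ∈ A.eigenspaceBaseChange K χ) :
    γ x ∈ A.eigenspaceBaseChange K χ :=
  A.apply_mem_eigenspaceBaseChange_of_comm K (γ := (γ : Module.End K (K ⊗[ℚ] V)))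
    (fun a y => Q.apply_baseChange_of_mem_lefschetzGroupBaseChange K (A.ι a) (A.map_F_le a) hγ y) hx

/-- **The block `γ|V_{K,χ} ∈ GL(V_{K,χ})` of `γ ∈ S(H)(K)`** (inverse `γ⁻¹|V_{K,χ}`) — Milne's `α ↦ α|V₁` (and `α ↦ α|V₂`), for
every embedding `χ`. [cite: Milne1999LefschetzClasses, §2 Remark 2.2 (p. 647 L69 – p. 648 L7, "the map α ↦ α|V₁ : U(φ)_Ω → GL(V₁)")] -/
def Polarization.restrictBlockEquiv {γ : (K ⊗[ℚ] V) ≃ₗ[K] (K ⊗[ℚ] V)} (hγ : γ ∈ Q.lefschetzGroupBaseChange K)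
    (χ : F →ₐ[ℚ] K) : A.eigenspaceBaseChange K χ ≃ₗ[K] A.eigenspaceBaseChange K χ :=
  LinearEquiv.ofLinear
    ((γ : Module.End K (K ⊗[ℚ] V)).restrict fun _ hx =>
      A.apply_mem_eigenspaceBaseChange_of_mem_lefschetzGroupBaseChange K Q hγ χ hx)
    (((γ⁻¹ : (K ⊗[ℚ] V) ≃ₗ[K] (K ⊗[ℚ] V)) : Module.End K (K ⊗[ℚ] V)).restrict fun _ hx =>
      A.apply_mem_eigenspaceBaseChange_of_mem_lefschetzGroupBaseChange K Q (inv_mem hγ) χ hx)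
    (LinearMap.ext fun x => Subtype.ext (γ.apply_symm_apply (x : K ⊗[ℚ] V)))
    (LinearMap.ext fun x => Subtype.ext (γ.symm_apply_apply (x : K ⊗[ℚ] V)))

/-- `γ|V_{K,χ} x = γ x`. [cite: Milne1999LefschetzClasses, §2 Remark 2.2 (p. 647 L69 – p. 648 L7)] -/
@[simp] theorem Polarization.coe_restrictBlockEquiv_apply {γ : (K ⊗[ℚ] V) ≃ₗ[K] (K ⊗[ℚ] V)}
    (hγ : γ ∈ Q.lefschetzGroupBaseChange K) (χ : F →ₐ[ℚ] K) (x : A.eigenspaceBaseChange K χ) :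
    ((Q.restrictBlockEquiv K A hγ χ x : A.eigenspaceBaseChange K χ) : K ⊗[ℚ] V) = γ x :=
  rfl

/-- `(γ|V_{K,χ})⁻¹ x = γ⁻¹ x`. [cite: Milne1999LefschetzClasses, §2 Remark 2.2 (p. 647 L69 – p. 648 L7)] -/
@[simp] theorem Polarization.coe_restrictBlockEquiv_symm_apply {γ : (K ⊗[ℚ] V) ≃ₗ[K] (K ⊗[ℚ] V)}
    (hγ : γ ∈ Q.lefschetzGroupBaseChange K) (χ : F →ₐ[ℚ] K) (x : A.eigenspaceBaseChange K χ) :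
    (((Q.restrictBlockEquiv K A hγ χ).symm x : A.eigenspaceBaseChange K χ) : K ⊗[ℚ] V) = γ.symm x :=
  rfl

/-- `γ⁻¹|V_{K,χ} = (γ|V_{K,χ})⁻¹`. [cite: Milne1999LefschetzClasses, §2 Remark 2.2 (p. 647 L69 – p. 648 L7)] -/
theorem Polarization.restrictBlockEquiv_inv {γ : (K ⊗[ℚ] V) ≃ₗ[K] (K ⊗[ℚ] V)}
    (hγ : γ ∈ Q.lefschetzGroupBaseChange K) (χ : F →ₐ[ℚ] K) :
    Q.restrictBlockEquiv K A (inv_mem hγ) χ = (Q.restrictBlockEquiv K A hγ χ).symm :=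
  LinearEquiv.ext fun _ => Subtype.ext rfl

section Pair

variable [Fintype S] [Module.Finite ℚ V] (κ : S → S) (Φ : Finset S)
variable (hτ : Injective τ) (hcard : Fintype.card S = finrank ℚ F)
  (hros : ∀ a v w, Q.form (A.ι a v) w = Q.form v (A.ι (σ a) w)) (hσ : ∀ a, σ (σ a) = a)
  (hκ : ∀ s, τ (κ s) = (τ s).comp (σ : F →ₐ[ℚ] F))
  (hΦ₁ : ∀ s, s ∈ Φ ∨ κ s ∈ Φ) (hΦ₂ : ∀ s ∈ Φ, κ s ∉ Φ)
  (hcent : ∀ a ∈ H.endAlg, ∀ f : F, a * A.ι f = A.ι f * a)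

include hτ hcard hros hσ hκ in
/-- **`V_{K,τₛ∘σ} ≅ V_{K,τₛ}^∨`, `y ↦ Q_K(·, y)`** — Milne's "`V₂ = V₁^∨`" with "`φ₀(x₁, x₂) = x₂(x₁)`": the duality of the two
blocks of a conjugate pair given by the perfect pairing `Q_K : V_{K,τₛ} × V_{K,τₛ∘σ} → K` of Remark 2.2 (the Rosati condition
`Q(ι(a)v, w) = Q(v, ι(σa)w)` for an involution `σ` of `F`, a field `K` admitting all `[F:ℚ]` embeddings `τ`, the index involution
`κ`). [cite: Milne1999LefschetzClasses, §2 p. 650 L72 – p. 651 L2 ("Let V₂ = V₁^∨ … φ₀(x₁, x₂) = x₂(x₁)") and Remark 2.2 (p. 647 L66–L69)] -/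
def Polarization.blockDuality (s : S) :
    A.eigenspaceBaseChange K ((τ s).comp (σ : F →ₐ[ℚ] F)) ≃ₗ[K] Module.Dual K (A.eigenspaceBaseChange K (τ s)) :=
  haveI := Q.isPerfPair_blockPairing K A τ σ κ hτ hcard hros hσ hκ s
  LinearMap.toPerfPair (R := K) (M := A.eigenspaceBaseChange K ((τ s).comp (σ : F →ₐ[ℚ] F)))
    (N := A.eigenspaceBaseChange K (τ s)) (Q.blockPairing K A (τ s) ((τ s).comp (σ : F →ₐ[ℚ] F))).flip

/-- `blockDuality y x = Q_K(x, y)` ("`φ₀(x₁, x₂) = x₂(x₁)`"). [cite: Milne1999LefschetzClasses, §2 p. 650 L76 – p. 651 L2] -/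
@[simp] theorem Polarization.blockDuality_apply (s : S) (y : A.eigenspaceBaseChange K ((τ s).comp (σ : F →ₐ[ℚ] F)))
    (x : A.eigenspaceBaseChange K (τ s)) :
    Q.blockDuality K A τ σ κ hτ hcard hros hσ hκ s y x = Q.form.baseChange K (x : K ⊗[ℚ] V) (y : K ⊗[ℚ] V) :=
  rfl

/-- **"The representation on `V₂` is the contragredient of the standard representation": `γ|V_{K,τₛ∘σ} = ᵗ(γ|V_{K,τₛ})⁻¹`** under
`V_{K,τₛ∘σ} ≅ V_{K,τₛ}^∨`, for `γ ∈ S(H)(K)` — `Q_K(x, γy) = Q_K(γ⁻¹x, y)` because `γ` preserves `Q_K`.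
[cite: Milne1999LefschetzClasses, §2 Remark 2.2 (p. 648 L5–L7, "the representation of GL(V₁) on V₂ (contragredient of the standard representation)") and p. 651 L79–L81] -/
theorem Polarization.blockDuality_restrictBlockEquiv {γ : (K ⊗[ℚ] V) ≃ₗ[K] (K ⊗[ℚ] V)}
    (hγ : γ ∈ Q.lefschetzGroupBaseChange K) (s : S) (y : A.eigenspaceBaseChange K ((τ s).comp (σ : F →ₐ[ℚ] F))) :
    Q.blockDuality K A τ σ κ hτ hcard hros hσ hκ s (Q.restrictBlockEquiv K A hγ ((τ s).comp (σ : F →ₐ[ℚ] F)) y) =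
      (Q.restrictBlockEquiv K A hγ (τ s)).symm.dualMap (Q.blockDuality K A τ σ κ hτ hcard hros hσ hκ s y) := by
  refine LinearMap.ext fun x => ?_
  rw [LinearEquiv.dualMap_apply, Q.blockDuality_apply K A τ σ κ hτ hcard hros hσ hκ, Q.blockDuality_apply K A τ σ κ hτ hcard hros hσ hκ,
    Q.coe_restrictBlockEquiv_apply K A hγ, Q.coe_restrictBlockEquiv_symm_apply K A hγ]
  conv_lhs => rw [← γ.apply_symm_apply (x : K ⊗[ℚ] V)]
  exact Q.baseChange_form_apply_apply_of_mem_lefschetzGroupBaseChange hγ _ _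

/-! ## §2 Corner level: with a splitting `ρₛ : M_ι(K) → End_K(V_{K,τₛ})`, `V_{K,τₛ} ≅ (eV)^ι` carries `d` copies of the
standard representation of `γ|eV` and `V_{K,τₛ∘σ} ≅ ((eV)^∨)^ι` carries `d` copies of its contragredient -/

variable {ι : Φ → Type*} [∀ s, Fintype (ι s)] [∀ s, DecidableEq (ι s)] (i₀ : ∀ s, ι s)
  (ρ : ∀ s : Φ, Matrix (ι s) (ι s) K →ₐ[K] A.BlockEnd K (τ s))
  (hρ : ∀ s : Φ, Submodule.span K (Set.range (A.blockOp K hcent (τ s))) = LinearMap.range (ρ s).toLinearMap)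

/-- Dictionary: `γ|V_{K,τₛ}` IS the `s`-component of the seat's `S(H)(K) ≃* ∏_{s ∈ Φ} Aut_{E_φ ⊗ K}(V_{K,τₛ})` (both are
restriction). [cite: Milne1999LefschetzClasses, §2 p. 651 L72–L79 ("S(A)_{/k^al} = ∏ S_σ where S_σ ≈ Aut_{M_d(k^al)}(V₁)")] -/
theorem Polarization.restrictBlockEquiv_eq_coe_lefschetzGroupBaseChangeEquivBlockCentralizers (γ : Q.lefschetzGroupBaseChange K)
    (s : Φ) :
    Q.restrictBlockEquiv K A γ.2 (τ s) =
      ((Q.lefschetzGroupBaseChangeEquivBlockCentralizers K A τ σ κ Φ hτ hcard hros hσ hκ hΦ₁ hΦ₂ hcent γ s :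
        A.blockCentralizer K hcent (τ s)) : A.eigenspaceBaseChange K (τ s) ≃ₗ[K] A.eigenspaceBaseChange K (τ s)) :=
  LinearEquiv.ext fun x => Subtype.ext (by
    rw [Q.coe_restrictBlockEquiv_apply K A γ.2,
      Q.coe_lefschetzGroupBaseChangeEquivBlockCentralizers_apply K A τ σ κ Φ hτ hcard hros hσ hκ hΦ₁ hΦ₂ hcent])

include hτ hcard hros hσ hκ hΦ₁ hΦ₂ hρ in
/-- **`γ|V_{K,τₛ}` commutes with the matrix units `u_{kl} = ρₛ(E_{kl})`** (they lie in `K·(E_φ|V_{K,τₛ}) = ρₛ(M_ι(K))`, with which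
`γ ∈ S(H)(K)` commutes): `γ ∈ Aut_{M_d(k^al)}(V₁)`. [cite: Milne1999LefschetzClasses, §2 p. 651 L79 ("S_σ ≈ Aut_{M_d(k^al)}(V₁)")] -/
theorem Polarization.restrictBlockEquiv_comp_unit (γ : Q.lefschetzGroupBaseChange K) (s : Φ) (k l : ι s) :
    ((Q.restrictBlockEquiv K A γ.2 (τ s) : A.eigenspaceBaseChange K (τ s) ≃ₗ[K] A.eigenspaceBaseChange K (τ s)) :
        A.BlockEnd K (τ s)) * MatrixAlgAction.unit (ρ s) k l =
      MatrixAlgAction.unit (ρ s) k l *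
        ((Q.restrictBlockEquiv K A γ.2 (τ s) : A.eigenspaceBaseChange K (τ s) ≃ₗ[K] A.eigenspaceBaseChange K (τ s)) :
          A.BlockEnd K (τ s)) := by
  have hmem : Q.restrictBlockEquiv K A γ.2 (τ s) ∈
      MatrixAlgAction.isometryCentralizer (L := K) (W := A.eigenspaceBaseChange K (τ s)) (Set.range (ρ s)) 0 := by
    rw [Q.restrictBlockEquiv_eq_coe_lefschetzGroupBaseChangeEquivBlockCentralizers K A τ σ κ Φ hτ hcard hros hσ hκ hΦ₁ hΦ₂ hcent,
      ← A.blockCentralizer_eq_isometryCentralizer_range K τ Φ hcent ρ hρ s]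
    exact Subtype.coe_prop _
  exact ((MatrixAlgAction.mem_isometryCentralizer_range_iff (ρ := ρ s) 0 _).1 hmem).1 k l

include hτ hcard hros hσ hκ hΦ₁ hΦ₂ hρ in
/-- `γ (u_{kl} x) = u_{kl} (γ x)` on `V_{K,τₛ}`, in `K ⊗ V`. [cite: Milne1999LefschetzClasses, §2 p. 651 L79] -/
theorem Polarization.apply_coe_unit_apply (γ : Q.lefschetzGroupBaseChange K) (s : Φ) (k l : ι s)
    (x : A.eigenspaceBaseChange K (τ s)) :
    (γ : (K ⊗[ℚ] V) ≃ₗ[K] (K ⊗[ℚ] V)) ((MatrixAlgAction.unit (ρ s) k l x : A.eigenspaceBaseChange K (τ s)) : K ⊗[ℚ] V) =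
      ((MatrixAlgAction.unit (ρ s) k l (Q.restrictBlockEquiv K A γ.2 (τ s) x) : A.eigenspaceBaseChange K (τ s)) : K ⊗[ℚ] V) := by
  have h := LinearMap.congr_fun (Q.restrictBlockEquiv_comp_unit K A τ σ κ Φ hτ hcard hros hσ hκ hΦ₁ hΦ₂ hcent ρ hρ γ s k l) x
  rw [Module.End.mul_apply, Module.End.mul_apply] at h
  exact (congr_arg Subtype.val h :)

/-- **"`d` copies of the standard representation"**: in `V_{K,τₛ} ≅ (e V_{K,τₛ})^ι`, `v ↦ (u_{i₀ j} v)_j`, the element `γ ∈ S(H)(K)`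
acts coordinatewise through `γ|eV_{K,τₛ}` — the `s`-component of the seat's `S(H)(K) ≃* ∏_{s ∈ Φ} GL(e V_{K,τₛ})` ("`S_σ ≈
Aut_{M_d(k^al)}(V₁) ≈ GL_{g/fd}(k^al)`"): `(γ v)_j = γ|eV (v_j)`.
[cite: Milne1999LefschetzClasses, §2 p. 651 L79–L81 ("d copies of the standard representation of GL_{g/fd}(k^al)") and Remark 2.3 (p. 648 L13–L17)] -/
theorem Polarization.cornerDecomposition_restrictBlockEquiv_apply (γ : Q.lefschetzGroupBaseChange K) (s : Φ)
    (v : A.eigenspaceBaseChange K (τ s)) (j : ι s) :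
    MatrixAlgAction.cornerDecomposition (ρ s) (i₀ s) (Q.restrictBlockEquiv K A γ.2 (τ s) v) j =
      Q.lefschetzGroupBaseChangeEquivCornerBlocks K A τ σ κ Φ hτ hcard hros hσ hκ hΦ₁ hΦ₂ hcent i₀ ρ hρ γ s
        (MatrixAlgAction.cornerDecomposition (ρ s) (i₀ s) v j) := by
  refine Subtype.ext (Subtype.ext ?_)
  rw [MatrixAlgAction.cornerDecomposition_apply, MatrixAlgAction.cornerDecomposition_apply, MatrixAlgAction.coe_toCorner_apply,
    Q.coe_lefschetzGroupBaseChangeEquivCornerBlocks_apply K A τ σ κ Φ hτ hcard hros hσ hκ hΦ₁ hΦ₂ hcent i₀ ρ hρ,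
    MatrixAlgAction.coe_toCorner_apply]
  exact (Q.apply_coe_unit_apply K A τ σ κ Φ hτ hcard hros hσ hκ hΦ₁ hΦ₂ hcent ρ hρ γ s (i₀ s) j v).symm

include hτ hcard hros hσ hκ in
/-- **`V_{K,τₛ∘σ} ≅ ((e V_{K,τₛ})^∨)^ι`, `y ↦ (x ↦ Q_K(u_{j i₀} x, y))_j`** — Milne's `V₂ = V₁^∨ = (S ⊕ ⋯ ⊕ S)^∨`: the duality
`blockDuality` followed by the transpose of `V_{K,τₛ} ≅ (e V_{K,τₛ})^ι` (`MatrixAlgAction.cornerDecomposition`, inverse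
`(x_j) ↦ Σ_j u_{j i₀} x_j`) and `((eV)^ι)^∨ ≅ ((eV)^∨)^ι`. [cite: Milne1999LefschetzClasses, §2 p. 650 L66 – p. 651 L2 ("V₁ = S ⊕ ⋯ ⊕ S (g/df copies) … Let V₂ = V₁^∨")] -/
def Polarization.partnerDualDecomposition (s : Φ) :
    A.eigenspaceBaseChange K ((τ (s : S)).comp (σ : F →ₐ[ℚ] F)) ≃ₗ[K]
      (ι s → Module.Dual K (MatrixAlgAction.corner (ρ s) (i₀ s))) :=
  (Q.blockDuality K A τ σ κ hτ hcard hros hσ hκ s).trans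
    ((MatrixAlgAction.cornerDecomposition (ρ s) (i₀ s)).symm.dualMap.trans
      (LinearMap.lsum K (fun _ : ι s => MatrixAlgAction.corner (ρ s) (i₀ s)) K).symm)

omit [Fintype S] [Module.Finite ℚ V] in
/-- `Σ_k u_{k i₀} (δ_{jk} x) = u_{j i₀} x`: the inverse decomposition map on a coordinate vector (private plumbing). [folklore] -/
private theorem cornerDecomposition_symm_single (s : Φ) (j : ι s)
    (x : MatrixAlgAction.corner (ρ s) (i₀ s)) :
    (MatrixAlgAction.cornerDecomposition (ρ s) (i₀ s)).symm (Pi.single j x) = MatrixAlgAction.fromCorner (ρ s) (i₀ s) j x := by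
  rw [LinearEquiv.symm_apply_eq]
  funext k
  rw [MatrixAlgAction.cornerDecomposition_apply]
  by_cases hkj : k = j
  · subst hkj
    rw [Pi.single_eq_same, MatrixAlgAction.toCorner_fromCorner_same]
  · rw [Pi.single_eq_of_ne hkj, MatrixAlgAction.toCorner_fromCorner_of_ne (ρ s) (i₀ s) hkj]

/-- **The coordinates of `y ∈ V_{K,τₛ∘σ}`: `(partnerDualDecomposition y)_j (x) = Q_K(u_{j i₀} x, y)`** (Milne's `φ₀(x₁, x₂) = x₂(x₁)`
on the `j`-th copy of `S`). [cite: Milne1999LefschetzClasses, §2 p. 650 L76 – p. 651 L2] -/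
@[simp] theorem Polarization.partnerDualDecomposition_apply (s : Φ)
    (y : A.eigenspaceBaseChange K ((τ (s : S)).comp (σ : F →ₐ[ℚ] F))) (j : ι s) (x : MatrixAlgAction.corner (ρ s) (i₀ s)) :
    Q.partnerDualDecomposition K A τ σ κ Φ hτ hcard hros hσ hκ i₀ ρ s y j x =
      Q.form.baseChange K ((MatrixAlgAction.unit (ρ s) j (i₀ s) (x : A.eigenspaceBaseChange K (τ s)) :
        A.eigenspaceBaseChange K (τ s)) : K ⊗[ℚ] V) (y : K ⊗[ℚ] V) := by
  show (LinearMap.lsum K (fun _ : ι s => MatrixAlgAction.corner (ρ s) (i₀ s)) K).symm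
      ((MatrixAlgAction.cornerDecomposition (ρ s) (i₀ s)).symm.dualMap (Q.blockDuality K A τ σ κ hτ hcard hros hσ hκ s y)) j x = _
  rw [LinearMap.lsum_symm_apply, LinearMap.comp_apply, LinearEquiv.dualMap_apply, LinearMap.coe_single,
    cornerDecomposition_symm_single K A τ Φ i₀ ρ s j x, Q.blockDuality_apply K A τ σ κ hτ hcard hros hσ hκ,
    MatrixAlgAction.fromCorner_apply]

/-- **"`d` copies of its contragredient"**: in `V_{K,τₛ∘σ} ≅ ((e V_{K,τₛ})^∨)^ι` the element `γ ∈ S(H)(K)` acts coordinatewise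
through the CONTRAGREDIENT `φ ↦ φ ∘ (γ|eV_{K,τₛ})⁻¹` of its image `γ|eV_{K,τₛ} ∈ GL(e V_{K,τₛ})`: `(γ y)_j = y_j ∘ (γ|eV)⁻¹`
(`γ` preserves `Q_K` and `γ⁻¹` commutes with `u_{j i₀}`).
[cite: Milne1999LefschetzClasses, §2 p. 651 L79–L81 ("and d copies of its contragredient") and Remark 2.2 (p. 648 L5–L7)] -/
theorem Polarization.partnerDualDecomposition_restrictBlockEquiv_apply (γ : Q.lefschetzGroupBaseChange K) (s : Φ)
    (y : A.eigenspaceBaseChange K ((τ (s : S)).comp (σ : F →ₐ[ℚ] F))) (j : ι s) :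
    Q.partnerDualDecomposition K A τ σ κ Φ hτ hcard hros hσ hκ i₀ ρ s
        (Q.restrictBlockEquiv K A γ.2 ((τ (s : S)).comp (σ : F →ₐ[ℚ] F)) y) j =
      (Q.lefschetzGroupBaseChangeEquivCornerBlocks K A τ σ κ Φ hτ hcard hros hσ hκ hΦ₁ hΦ₂ hcent i₀ ρ hρ γ s).symm.dualMap
        (Q.partnerDualDecomposition K A τ σ κ Φ hτ hcard hros hσ hκ i₀ ρ s y j) := by
  refine LinearMap.ext fun x => ?_
  rw [LinearEquiv.dualMap_apply, Q.partnerDualDecomposition_apply K A τ σ κ Φ hτ hcard hros hσ hκ i₀ ρ,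
    Q.partnerDualDecomposition_apply K A τ σ κ Φ hτ hcard hros hσ hκ i₀ ρ, Q.coe_restrictBlockEquiv_apply K A γ.2]
  -- `(γ|eV)⁻¹ = γ⁻¹|eV`, whose action on `K ⊗ V` is `γ⁻¹`
  have hinv : (Q.lefschetzGroupBaseChangeEquivCornerBlocks K A τ σ κ Φ hτ hcard hros hσ hκ hΦ₁ hΦ₂ hcent i₀ ρ hρ γ s).symm =
      Q.lefschetzGroupBaseChangeEquivCornerBlocks K A τ σ κ Φ hτ hcard hros hσ hκ hΦ₁ hΦ₂ hcent i₀ ρ hρ γ⁻¹ s := by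
    rw [map_inv, Pi.inv_apply]; rfl
  have hx : (((Q.lefschetzGroupBaseChangeEquivCornerBlocks K A τ σ κ Φ hτ hcard hros hσ hκ hΦ₁ hΦ₂ hcent i₀ ρ hρ γ s).symm x :
      MatrixAlgAction.corner (ρ s) (i₀ s)) : A.eigenspaceBaseChange K (τ s)) =
        Q.restrictBlockEquiv K A (γ⁻¹).2 (τ s) (x : A.eigenspaceBaseChange K (τ s)) := by
    refine Subtype.ext ?_
    rw [hinv, Q.coe_lefschetzGroupBaseChangeEquivCornerBlocks_apply K A τ σ κ Φ hτ hcard hros hσ hκ hΦ₁ hΦ₂ hcent i₀ ρ hρ,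
      Q.coe_restrictBlockEquiv_apply K A (γ⁻¹).2]
  rw [hx, ← Q.apply_coe_unit_apply K A τ σ κ Φ hτ hcard hros hσ hκ hΦ₁ hΦ₂ hcent ρ hρ γ⁻¹ s]
  conv_lhs => rw [← (γ : (K ⊗[ℚ] V) ≃ₗ[K] (K ⊗[ℚ] V)).apply_symm_apply
    ((MatrixAlgAction.unit (ρ s) j (i₀ s) (x : A.eigenspaceBaseChange K (τ s)) : A.eigenspaceBaseChange K (τ s)) : K ⊗[ℚ] V)]
  rw [Q.baseChange_form_apply_apply_of_mem_lefschetzGroupBaseChange γ.2]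
  rfl

/-! ## §3 The pair `V_σ = V_{K,τₛ} ⊕ V_{K,τₛ∘σ} ≅ (eV)^ι ⊕ ((eV)^∨)^ι`: `d` copies of the standard representation of
`GL(e V_{K,τₛ})` and `d` copies of its contragredient -/

include hτ hcard hros hσ hκ in
/-- **`V_σ = V₁ ⊕ V₂ ≅ (eV)^ι ⊕ ((eV)^∨)^ι`**: the pair of blocks `V_{K,τₛ} × V_{K,τₛ∘σ}` of a representative `s ∈ Φ`, decomposed
by `cornerDecomposition` and `partnerDualDecomposition` ("`V₁ = S ⊕ ⋯ ⊕ S`, `V₂ = V₁^∨`").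
[cite: Milne1999LefschetzClasses, §2 p. 650 L66 – p. 651 L6 ("V₁ = S ⊕ ⋯ ⊕ S … V₂ = V₁^∨ … V̄ = V₁ ⊕ V₂")] -/
def Polarization.pairDecomposition (s : Φ) :
    (A.eigenspaceBaseChange K (τ (s : S)) × A.eigenspaceBaseChange K ((τ (s : S)).comp (σ : F →ₐ[ℚ] F))) ≃ₗ[K]
      ((ι s → MatrixAlgAction.corner (ρ s) (i₀ s)) × (ι s → Module.Dual K (MatrixAlgAction.corner (ρ s) (i₀ s)))) :=
  (MatrixAlgAction.cornerDecomposition (ρ s) (i₀ s)).prodCongr (Q.partnerDualDecomposition K A τ σ κ Φ hτ hcard hros hσ hκ i₀ ρ s)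

/-- Unfolding of `pairDecomposition`. [cite: Milne1999LefschetzClasses, §2 p. 651 L5–L6 ("V̄ = V₁ ⊕ V₂")] -/
@[simp] theorem Polarization.pairDecomposition_apply (s : Φ)
    (v : A.eigenspaceBaseChange K (τ (s : S))) (y : A.eigenspaceBaseChange K ((τ (s : S)).comp (σ : F →ₐ[ℚ] F))) :
    Q.pairDecomposition K A τ σ κ Φ hτ hcard hros hσ hκ i₀ ρ s (v, y) =
      (MatrixAlgAction.cornerDecomposition (ρ s) (i₀ s) v, Q.partnerDualDecomposition K A τ σ κ Φ hτ hcard hros hσ hκ i₀ ρ s y) :=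
  rfl

/-- **Milne: "The representation of `S_σ` on `V_σ` is isomorphic to the direct sum of `d` copies of the standard representation of
`GL_{g/fd}(k^al)` and `d` copies of its contragredient."** On `K`-points: for `γ ∈ S(H)(K)` with image
`g = γ|eV_{K,τₛ} ∈ GL(e V_{K,τₛ})` under the `s`-component of the seat's `S(H)(K) ≃* ∏_{s ∈ Φ} GL(e V_{K,τₛ})`
(`Polarization.lefschetzGroupBaseChangeEquivCornerBlocks`, Milne's `S_σ ≈ GL_{g/fd}(k^al)`), the action of `γ` on the pair
`V_{K,τₛ} × V_{K,τₛ∘σ} ≅ (eV)^ι × ((eV)^∨)^ι` is `((g v_j)_j, (φ_j ∘ g⁻¹)_j)` — `card ι = d` copies of the standard representation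
and `d` copies of its contragredient. [cite: Milne1999LefschetzClasses, §2 p. 651 L79–L81] -/
theorem Polarization.pairDecomposition_restrictBlockEquiv (γ : Q.lefschetzGroupBaseChange K) (s : Φ)
    (v : A.eigenspaceBaseChange K (τ (s : S))) (y : A.eigenspaceBaseChange K ((τ (s : S)).comp (σ : F →ₐ[ℚ] F))) :
    Q.pairDecomposition K A τ σ κ Φ hτ hcard hros hσ hκ i₀ ρ s
        (Q.restrictBlockEquiv K A γ.2 (τ (s : S)) v, Q.restrictBlockEquiv K A γ.2 ((τ (s : S)).comp (σ : F →ₐ[ℚ] F)) y) =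
      (fun j : ι s => Q.lefschetzGroupBaseChangeEquivCornerBlocks K A τ σ κ Φ hτ hcard hros hσ hκ hΦ₁ hΦ₂ hcent i₀ ρ hρ γ s
          (MatrixAlgAction.cornerDecomposition (ρ s) (i₀ s) v j),
        fun j : ι s => (Q.lefschetzGroupBaseChangeEquivCornerBlocks K A τ σ κ Φ hτ hcard hros hσ hκ hΦ₁ hΦ₂ hcent i₀ ρ hρ γ s).symm.dualMap
          (Q.partnerDualDecomposition K A τ σ κ Φ hτ hcard hros hσ hκ i₀ ρ s y j)) := by
  rw [Q.pairDecomposition_apply K A τ σ κ Φ hτ hcard hros hσ hκ i₀ ρ]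
  refine Prod.ext (funext fun j => ?_) (funext fun j => ?_)
  · exact Q.cornerDecomposition_restrictBlockEquiv_apply K A τ σ κ Φ hτ hcard hros hσ hκ hΦ₁ hΦ₂ hcent i₀ ρ hρ γ s v j
  · exact Q.partnerDualDecomposition_restrictBlockEquiv_apply K A τ σ κ Φ hτ hcard hros hσ hκ hΦ₁ hΦ₂ hcent i₀ ρ hρ γ s y j

/-- **Every `g ∈ GL(e V_{K,τₛ})` occurs**: the standard-plus-contragredient action of an ARBITRARY family
`g ∈ ∏_{s ∈ Φ} GL(e V_{K,τₛ})` on the pairs is the action of the unique `γ ∈ S(H)(K)` with blocks `g` (surjectivity of the seat's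
`S(H)(K) ≃* ∏_{s ∈ Φ} GL(e V_{K,τₛ})`) — "`S_σ ≈ GL_{g/fd}(k^al)`", so the representation of `S_σ` IS that of the full `GL`.
[cite: Milne1999LefschetzClasses, §2 p. 651 L79–L81] -/
theorem Polarization.pairDecomposition_restrictBlockEquiv_symm
    (g : ∀ s : Φ, MatrixAlgAction.corner (ρ s) (i₀ s) ≃ₗ[K] MatrixAlgAction.corner (ρ s) (i₀ s)) (s : Φ)
    (v : A.eigenspaceBaseChange K (τ (s : S))) (y : A.eigenspaceBaseChange K ((τ (s : S)).comp (σ : F →ₐ[ℚ] F))) :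
    Q.pairDecomposition K A τ σ κ Φ hτ hcard hros hσ hκ i₀ ρ s
        (Q.restrictBlockEquiv K A
            ((Q.lefschetzGroupBaseChangeEquivCornerBlocks K A τ σ κ Φ hτ hcard hros hσ hκ hΦ₁ hΦ₂ hcent i₀ ρ hρ).symm g).2 (τ (s : S)) v,
          Q.restrictBlockEquiv K A
            ((Q.lefschetzGroupBaseChangeEquivCornerBlocks K A τ σ κ Φ hτ hcard hros hσ hκ hΦ₁ hΦ₂ hcent i₀ ρ hρ).symm g).2
            ((τ (s : S)).comp (σ : F →ₐ[ℚ] F)) y) =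
      (fun j : ι s => g s (MatrixAlgAction.cornerDecomposition (ρ s) (i₀ s) v j),
        fun j : ι s => (g s).symm.dualMap (Q.partnerDualDecomposition K A τ σ κ Φ hτ hcard hros hσ hκ i₀ ρ s y j)) := by
  rw [Q.pairDecomposition_restrictBlockEquiv K A τ σ κ Φ hτ hcard hros hσ hκ hΦ₁ hΦ₂ hcent i₀ ρ hρ, MulEquiv.apply_symm_apply]

end Pair

end HodgeStructure

end Literature.AlgebraicGeometry.Motives
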